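import Mathlib
import HarnessLib
import Summits.QuantumFields.Statement
import Summits.QuantumFields.QCD.Theses.HeatSlicedQuarks
import Literature.MathematicalPhysics.QuantumLattice.LatticeTori

/-!
# Sketch (ideator 1, generation 2) — first lemma of crux idea `drop-the-wilson-square`
# on `HeatSlicedQuarks.ActionBoundsLowModes` (stmt-QuantumFields-8872)

planner-cruxidea-stmt-QuantumFields-8872-1-g2-0, round 1.  Nothing below is proved except the
sanity implication `actionBoundsLowModes_of_windowFree`; every other `def … : Prop` is a candidate
statement of the line, stated over existing declarations only (`wilsonDirac`, `fundamentalRep`,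
`plaquetteHolonomy`, `wilsonAction`, `GaugeConfig`, `Site.shift`, `torusDist`).

The lever.  Neuberger's square completion of the Hermitian Wilson operator
(`H_W(m)² = D_W(m)ᴴ D_W(m) = (m + W_U)² + S̸_U² + i[W_U, S̸_U]`, `W_U = Σ_μ (1 − h_μ) = ½ K_U`,
`S̸_U = Σ_μ γ_μ ⊗ s_μ`, `h_μ = ½(T_μ + T_μᴴ)`, `s_μ = (T_μ − T_μᴴ)/2i`, `T_μ` the covariant shift),
read as a COUNTING input: DROP the Wilson square `(m + W_U)² ≥ 0`, keep the spin-scalar part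
`Σ_μ s_μ² = ¼ K_{U⁽²⁾}` of `S̸_U²` (the covariant Laplacian of the DOUBLED links
`U⁽²⁾(x,μ) = U(x,μ) U(x+μ̂,μ)`), and pay every remaining term — all of them commutators
`[T_μ^{±1}, T_ν^{±1}]`, `μ ≠ ν`, i.e. `(1 − U_□)`·(unitary) — by the local plaquette potential of
`WilsonLichnerowicz`.  Result: `D_W(m)ᴴD_W(m) ≥ ¼ K_{U⁽²⁾} ⊗ 1_spin − C·𝒱_U` for EVERY real mass `m`
(`NaiveKineticBound`), so the crux holds WITHOUT its mass window (`WindowFreeCount`) as soon as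
the bundle CLR junction of the other lines is known for the doubled field (`DoubledBundleCLR`,
which is `BundleCLR` after relabelling the 2ℤ⁴-cosets); the sixteen doublers of the naive kinetic
term cost a factor, never the statement.
-/

namespace Summit.QuantumFields.QCD.Cruxes.ActionBoundsLowModes.SketchG2

open scoped BigOperators Matrix ComplexConjugate
open Literature.MathematicalPhysics.QuantumLattice Literature.MathematicalPhysics.QuantumFieldTheory
  Literature.Probability.LatticeModels

/-- Shorthand: the quark-field index type on the torus of side `L`. -/
abbrev QIdx (L : ℕ) : Type := TorusSite 4 L × Fin 3 × Fin 4

local notation "SU3" => Matrix.specialUnitaryGroup (Fin 3) ℂ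

/-- Shorthand: the tree's Wilson–Dirac operator for `SU(3)`, `r = 1`. -/
noncomputable abbrev DW {L : ℕ} [NeZero L] (U : GaugeConfig 4 L SU3) (m : ℝ) :
    Matrix (QIdx L) (QIdx L) ℂ :=
  wilsonDirac (fundamentalRep (Fin 3)) U m 1

/-- The DOUBLED gauge field `U⁽²⁾(x, μ) = U(x, μ) · U(x + μ̂, μ)` (links of length two). Its
plaquettes are the `2 × 2` Wilson loops of `U`. -/
def doubledConfig {L : ℕ} (U : GaugeConfig 4 L SU3) : GaugeConfig 4 L SU3 :=
  fun e => U e * U (Site.shift e.1 e.2, e.2)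

/-- The NAIVE covariant kinetic form `⟨v, Σ_μ s_μ² v⟩ = Σ_μ ‖s_μ v‖²`,
`s_μ = (T_μ − T_μᴴ)/2i`, rewritten (shift the summation site by `μ̂` and use unitarity of the
link) as one quarter of the covariant Dirichlet form of the doubled field on double steps:
`¼ Σ_{x,μ} ‖U(x,μ)U(x+μ̂,μ) v(x+2μ̂) − v(x)‖²`.  Spin is a spectator. -/
noncomputable def naiveKinetic {L : ℕ} [NeZero L] (U : GaugeConfig 4 L SU3) (v : QIdx L → ℂ) : ℝ :=
  (1 / 4 : ℝ) * ∑ x : TorusSite 4 L, ∑ μ : Fin 4, ∑ a : Fin 3, ∑ α : Fin 4,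
    ‖(∑ b : Fin 3, (fundamentalRep (Fin 3) (doubledConfig U (x, μ))) a b *
        v (Site.shift (Site.shift x μ) μ, b, α)) - v (x, a, α)‖ ^ 2

/-- The local plaquette potential of `HeatSlicedQuarks.WilsonLichnerowicz` (verbatim):
`V(U,x) = Σ_{torusDist x y ≤ 3} Σ_{μ,ν} √(3 − Re tr U_{y,μν})`.  It dominates
`Σ_{□ near x} ‖1 − U_□‖_op` since `‖1 − U_□‖_op² ≤ ‖1 − U_□‖_HS² = 2 (3 − Re tr U_□)`, and
`Σ_x V(U,x)² ≤ C' · wilsonAction` by Cauchy–Schwarz (each plaquette lies within distance 3 of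
at most `7⁴` sites). -/
noncomputable def curvPot {L : ℕ} [NeZero L] (U : GaugeConfig 4 L SU3) (x : TorusSite 4 L) : ℝ :=
  ∑ y ∈ Finset.univ.filter (fun y : TorusSite 4 L => torusDist x y ≤ 3),
    ∑ μ : Fin 4, ∑ ν : Fin 4,
      Real.sqrt (3 - ((fundamentalRep (Fin 3)) (plaquetteHolonomy U y μ ν)).trace.re)

/-- FIRST LEMMA (all masses; replaces `WilsonLichnerowicz` and the mass pencil for this crux).
There is an absolute `C` such that for every torus, every `SU(3)` field, EVERY REAL MASS `m` and
every quark field `v`:  `Σ_μ ‖s_μ v‖² ≤ ‖D_W(U,m,1) v‖² + C Σ_x V(U,x) |v(x)|²`.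
Proof sketch (two identities and one Cauchy–Schwarz): `D_W(m) = (m + W) ⊗ 1 + i S̸` with
`W = Σ_μ(1 − h_μ)` Hermitian, `S̸ = Σ_μ γ_μ ⊗ s_μ` Hermitian, hence
`DᴴD = (m+W)² ⊗ 1 + S̸² + i[W, S̸]` and `S̸² = (Σ_μ s_μ²) ⊗ 1 + Σ_{μ<ν} γ_μγ_ν ⊗ [s_μ, s_ν]`
(Neuberger 2000, hep-lat/9911004, formula for `H_W²(m)`; `h_μ² + s_μ² = 1`, `[h_μ, s_μ] = 0`);
drop `(m+W)² ≥ 0`; every remaining term is `Γ ⊗ [T_μ^{±1}, T_ν^{±1}]` with `μ ≠ ν`, `Γ` a product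
of at most two `γ`'s, and `[T_μ^a, T_ν^b] = (1 − P) · T_μ^a T_ν^b` with `P` the site-diagonal
plaquette holonomy, so `|⟨v, Γ ⊗ [T_μ^a,T_ν^b] v⟩| ≤ Σ_x ‖1 − U_□(x)‖ |v(x)| |v(x + aμ̂ + bν̂)|
≤ ½ Σ_x ‖1 − U_□(x)‖ (|v(x)|² + |v(x+aμ̂+bν̂)|²)`; there are `48 + 96` such terms with coefficient
`⅛` (times `‖γ_μ ± γ_ν‖ ≤ 2`), whence `C ≤ 40`, say. No hypothesis on `m`, none on `U`. -/
def NaiveKineticBound : Prop :=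
  ∃ C : ℝ, ∀ (L : ℕ) [NeZero L] (U : GaugeConfig 4 L SU3) (m : ℝ) (v : QIdx L → ℂ),
    naiveKinetic U v ≤
      (∑ i, ‖(DW U m).mulVec v i‖ ^ 2) +
        C * ∑ x : TorusSite 4 L, curvPot U x * ∑ a : Fin 3, ∑ α : Fin 4, ‖v (x, a, α)‖ ^ 2

/-- THE JUNCTION, doubled form (discrete magnetic CLR for the naive kinetic term on the 4-torus,
Courant–Fischer form): an absolute `C` such that for every field and every site potential `W ≥ 0`,
any subspace on which `Σ_μ‖s_μ v‖² ≤ Σ_x W(x)|v(x)|²` has dimension `≤ C (Σ_x W(x)² + 1)`.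
It is the other ideators' `BundleCLR` for the doubled field `U⁽²⁾` restricted to the cosets of
`2ℤ⁴`: for odd `L` the double-step graph `(ℤ_L⁴, ±2e_μ)` is isomorphic to `(ℤ_L⁴, ±e_μ)` via
`y ↦ 2y` (one component); for even `L` it is 16 disjoint copies of `(ℤ_{L/2}⁴, ±e_μ)`; on each
component `naiveKinetic` is `¼ covForm(U⁽²⁾)` and the potential restricts, so
`DoubledBundleCLR ⇐ BundleCLR` with `C ↦ 16·C·4²` — the doublers cost a factor, not the statement.
Directly: the diagonal of `exp(−t Σ_μ s_μ²) = e^{−2t} exp((t/4) Σ_μ (T_μ² + T_μᴴ²))` is a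
positive double-hop path sum with unitary two-link holonomies, dominated by the free double-step
return probability `≤ C(t⁻² + 16 L⁻⁴)`, which is all any of the four filed engines consumes. -/
def DoubledBundleCLR : Prop :=
  ∃ C : ℝ, ∀ (L : ℕ) [NeZero L] (U : GaugeConfig 4 L SU3)
    (W : TorusSite 4 L → ℝ), (∀ x, 0 ≤ W x) →
    ∀ (E : Submodule ℂ (QIdx L → ℂ)),
      (∀ v ∈ E, naiveKinetic U v ≤
          ∑ x : TorusSite 4 L, W x * ∑ a : Fin 3, ∑ α : Fin 4, ‖v (x, a, α)‖ ^ 2) →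
      (Module.finrank ℂ E : ℝ) ≤ C * (∑ x : TorusSite 4 L, W x ^ 2 + 1)

/-- TRANSFER `C⁺` (window-free crux): the crux `ActionBoundsLowModes` with the hypothesis
`m ∈ [−½, 1]` DELETED — every real bare mass, same constant.  Stronger than the crux
(`actionBoundsLowModes_of_windowFree` below) and, by the lever, not harder:
`WindowFreeCount ⇐ NaiveKineticBound ∧ DoubledBundleCLR` (take `W = C·V(U,·) + λ + L⁻²`;
`Σ_x (C V)² ≤ C²C' S_W`, `Σ_x λ² = λ²L⁴`, `Σ_x L⁻⁴ = 1`). -/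
def WindowFreeCount : Prop :=
  ∃ C : ℝ, ∀ (L : ℕ) [NeZero L] (U : GaugeConfig 4 L SU3) (m : ℝ) (lam : ℝ), 0 ≤ lam →
    ∀ (E : Submodule ℂ (QIdx L → ℂ)),
      (∀ v ∈ E, ∑ i, ‖(DW U m).mulVec v i‖ ^ 2 ≤ lam * ∑ i, ‖v i‖ ^ 2) →
        (Module.finrank ℂ E : ℝ) ≤
          C * (lam ^ 2 * (L : ℝ) ^ 4 + wilsonAction (fundamentalRep (Fin 3)) U + 1)

/-- Sanity (proved): the window-free count is literally stronger than the crux. -/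
theorem actionBoundsLowModes_of_windowFree (h : WindowFreeCount) :
    Summit.QuantumFields.QCD.Theses.HeatSlicedQuarks.ActionBoundsLowModes := by
  obtain ⟨C, hC⟩ := h
  exact ⟨C, fun L _ U m _ lam hlam E hE => hC L U m lam hlam E hE⟩

/-- Shape of the line a crux-plan would check (stated, not proved here):
junction for the doubled field → all-mass kinetic bound → window-free count (→ crux, proved above).
The glue is linear algebra: on `E`, `naiveKinetic U v ≤ Σ_x (λ + C V(U,x) + L⁻²)|v(x)|²` by
`NaiveKineticBound` and the hypothesis, then `DoubledBundleCLR` with that `W`. -/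
def LineShape : Prop :=
  DoubledBundleCLR → NaiveKineticBound → WindowFreeCount

/-- REMARK (exact, recorded for triage; not used by the line above — accretivity + mass pencil +
min–max): low modes at a NEGATIVE mass are form-low modes of the MASSLESS operator at the shifted
level `(m₋ + √λ)²`, `m₋ = max(−m, 0)`: from `Re⟨v, D(m)v⟩ = m‖v‖² + ⟨v, W_U v⟩`
(`AccretiveWilsonDirac`) and `|Re⟨v,D v⟩| ≤ √λ ‖v‖²` on `E` one gets `⟨v, W_U v⟩ ≤ (m₋ + √λ)‖v‖²`,
and the pencil `‖D(0)v‖² = ‖D(m)v‖² − 2m⟨v,W_U v⟩ − m²‖v‖²` gives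
`‖D(0)v‖² ≤ λ + 2m₋(m₋ + √λ) − m₋² = (m₋ + √λ)²` (for `m ≥ 0` simply `‖D(0)v‖² ≤ λ`).
Lossless exactly when `m₋ ≲ √λ`; below the free gap (`λ ≪ m²`) it forgets the gap, which is why
the line uses `NaiveKineticBound` instead. -/
def NegativeMassTransfer : Prop :=
  ∀ (L : ℕ) [NeZero L] (U : GaugeConfig 4 L SU3) (m : ℝ) (lam : ℝ), 0 ≤ lam →
    ∀ (E : Submodule ℂ (QIdx L → ℂ)),
      (∀ v ∈ E, ∑ i, ‖(DW U m).mulVec v i‖ ^ 2 ≤ lam * ∑ i, ‖v i‖ ^ 2) →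
        ∀ v ∈ E, ∑ i, ‖(DW U 0).mulVec v i‖ ^ 2 ≤
          (max (-m) 0 + Real.sqrt lam) ^ 2 * ∑ i, ‖v i‖ ^ 2

end Summit.QuantumFields.QCD.Cruxes.ActionBoundsLowModes.SketchG2
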